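import Literature.MathematicalPhysics.QuantumLattice.QuantumSpinBlockChessboardEstimate
import HarnessLib

/-!
# Chessboard bounds for PARTIAL patterns: `⟨∏_{x ∈ D} P_x⟩ ≤ ⟨P_Λ⟩^{|D|/|Λ|}`
# (Fröhlich–Lieb 1978, eqs. (1.38), (1.42), (1.45); Fröhlich–Israel–Lieb–Simon 1978,
# Thm. 4.3 / Cor. 4.4)

Topic `MathematicalPhysics/QuantumLattice`; companion of `QuantumSpinChessboardEstimate.lean`
(one-site basic elements, `chessboard_estimate_gibbs_real`) and
`QuantumSpinBlockChessboardEstimate.lean` (cubes of side `b`,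
`chessboard_estimate_blocks_gibbs_real`). Those files state the chessboard estimate for
FULL labellings `σ : Λ → ι` of the torus. The form in which Fröhlich–Lieb USE it in the Peierls
argument (§I.D, "With (1.42) and (1.43) we have `Prob ≤ Σ_γ ⟨P_Λ⟩^{|γ|/2|Λ|}`") is the bound for a
pattern living on a SUBSET `D` of the basic elements, the other elements being free (observable
`1`):
the universal observable of the free label is `1`, whose expectation is `1`, so only the constrained
elements contribute:

* `re_gibbsState_productOp_universal_nonneg` — `0 ≤ Re⟨⨂_y f⟩_{β,H}` for a real `f` (the universal
  bound of a single label with itself);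
* **`chessboard_estimate_gibbs_finset`** —
  `|Re⟨⨂_{x ∈ D} f_{σ_x}⟩|^{L^d} ≤ ∏_{x ∈ D} Re⟨⨂_y f_{σ_x}⟩`
  (one-site elements, real single-site observables, free sites outside `D`);
* **`chessboard_estimate_gibbs_subset`**, **`re_gibbsState_productOp_subset_le_rpow`** — one label:
  `|Re⟨⨂_{x ∈ D} f⟩|^{L^d} ≤ Re⟨⨂_Λ f⟩^{|D|}`, i.e. `Re⟨⨂_{x ∈ D} f⟩ ≤ Re⟨⨂_Λ f⟩^{|D|/L^d}`
  (FL (1.38)/(1.45): "the probability that all sites of `D` are bad is at most the `|D|/|Λ|`-th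
  power of the probability that ALL sites are bad");
* **`chessboard_estimate_blocks_gibbs_finset`**, **`chessboard_estimate_blocks_gibbs_subset`**,
  **`re_gibbsState_blockPattern_subset_le_rpow`** — the same with cubes of side `b` as basic
  elements and FL's mirror-tiled universal projection `P_Λ(p)` (eq. (1.36)): a real pattern `p`
  placed (mirrored by block parity) on the cubes of `D ⊆ (ℤ/Nℤ)^d`, free elsewhere, has
  `Re⟨·⟩ ≤ Re⟨P_Λ(p)⟩^{|D|/N^d}` — eq. (1.42) for a contour piece `γ̃` made of `|D|` elements.

No named facts; no sorries.

## References

* J. Fröhlich, E. H. Lieb, *Phase transitions in anisotropic lattice spin systems*, Comm. Math.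
  Phys. **60** (1978) 233–267, §I.D eqs. (1.35)–(1.45), Thm. 2.2. [FrohlichLieb1978]
* J. Fröhlich, R. Israel, E. H. Lieb, B. Simon, *Phase transitions and reflection positivity. I*,
  Comm. Math. Phys. **62** (1978) 1–34, Thm. 4.3 and Cor. 4.4. [FrohlichIsraelLiebSimon1978]
-/

noncomputable section

open Matrix Finset NormedSpace
open scoped Kronecker ComplexOrder BigOperators
open Literature.MathematicalPhysics.QuantumLattice Literature.Probability.LatticeModels
  Literature.Barriers.CriticalPhenomena.NonGibbs

namespace Literature.MathematicalPhysics.QuantumLattice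

/-! ### One-site basic elements -/

section Sites

variable {d : ℕ} (L : ℕ) [NeZero L] {n : ℕ} {ι : Type*}

/-- `(1 : M_q(ℂ))` is a real matrix. [folklore] -/
private theorem subsetAux_map_conj_one {q : ℕ} :
    (1 : Matrix (Fin q) (Fin q) ℂ).map (starRingEnd ℂ) = 1 :=
  Matrix.map_one _ (map_zero _) (map_one _)

/-- The Gibbs state of a Hermitian Hamiltonian on the spin torus is normalised: `⟨1⟩ = 1`.
[folklore] -/
private theorem subsetAux_gibbsState_one {H : Op (TorusSite d L) (n + 1)} (hH : H.IsHermitian)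
    (β : ℝ) : Matrix.gibbsState β H 1 = 1 := by
  haveI : Nonempty (TensorIndex (TorusSite d L) (n + 1)) := ⟨fun _ => 0⟩
  exact Matrix.gibbsState_one β H (Matrix.partitionFn_pos β hH).ne'

/-- **The universal expectation is nonnegative**: `0 ≤ Re⟨⨂_y f⟩_{β,H}` for a real single-site
observable `f` and a Hermitian `H` with `-βH` reflection positive across all planes between sites
(the chessboard/Schwarz bound of the constant labelling against itself).
[cite: FrohlichLieb1978, Thm. 2.2 (1)] -/
theorem re_gibbsState_productOp_universal_nonneg (hd : 0 < d) (hL : Even L) {β : ℝ}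
    {H : Op (TorusSite d L) (n + 1)} (hH : H.IsHermitian)
    (hK : ∀ (j : Fin d) (a : ZMod L), IsRPExponent L j a hL (-(β : ℂ) • H))
    (f : Matrix (Fin (n + 1)) (Fin (n + 1)) ℂ) (hf : f.map (starRingEnd ℂ) = f) :
    0 ≤ (Matrix.gibbsState β H (productOp fun _ : TorusSite d L => f)).re := by
  haveI : Nonempty (TensorIndex (TorusSite d L) (n + 1)) := ⟨fun _ => 0⟩
  obtain ⟨hZ, hZeq⟩ := Matrix.partitionFn_re_pos β hH
  rw [Matrix.gibbsState_apply, hZeq, ← Complex.ofReal_inv, Complex.re_ofReal_mul, gibbsWeight,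
    Matrix.trace_mul_comm]
  exact mul_nonneg (inv_nonneg.2 hZ.le) (chessboard_universal_nonneg_real L hd hL hK f hf)

/-- **The chessboard estimate for a pattern on a subset of the sites** (one-site basic elements):
for real single-site observables `f_b`, a finite set of sites `D` and labels `σ` on it, the
observable `⨂_{x ∈ D} f_{σ_x}` (identity outside `D`) obeys
`|Re⟨⨂_{x ∈ D} f_{σ_x}⟩|^{L^d} ≤ ∏_{x ∈ D} Re⟨⨂_y f_{σ_x}⟩` — the free sites carry the label `1`,
whose universal observable is `1`. [cite: FrohlichLieb1978, Thm. 2.2 (1), eqs. (1.38), (1.42)] -/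
theorem chessboard_estimate_gibbs_finset (hd : 0 < d) (hL : Even L) {β : ℝ}
    {H : Op (TorusSite d L) (n + 1)} (hH : H.IsHermitian)
    (hK : ∀ (j : Fin d) (a : ZMod L), IsRPExponent L j a hL (-(β : ℂ) • H))
    (f : ι → Matrix (Fin (n + 1)) (Fin (n + 1)) ℂ) (hf : ∀ b, (f b).map (starRingEnd ℂ) = f b)
    (D : Finset (TorusSite d L)) (σ : TorusSite d L → ι) :
    |(Matrix.gibbsState β H (productOp fun x => if x ∈ D then f (σ x) else 1)).re| ^ (L ^ d) ≤
      ∏ x ∈ D, (Matrix.gibbsState β H (productOp fun _ : TorusSite d L => f (σ x))).re := by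
  classical
  -- labels `Option ι`, the free label `none` carrying the identity
  set F : Option ι → Matrix (Fin (n + 1)) (Fin (n + 1)) ℂ := fun o => o.elim 1 f with hF
  have hFreal : ∀ o, (F o).map (starRingEnd ℂ) = F o := by
    rintro (_ | b)
    · exact subsetAux_map_conj_one
    · exact hf b
  set τ : TorusSite d L → Option ι := fun x => if x ∈ D then some (σ x) else none with hτ
  have hobs : (productOp fun x => if x ∈ D then f (σ x) else 1) =
      productOp fun x => F (τ x) := by
    congr 1
    funext x
    simp only [hτ, hF]
    split_ifs <;> rfl
  have h := chessboard_estimate_gibbs_real L hd hL hH hK F hFreal τ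
  rw [← hobs] at h
  refine h.trans (le_of_eq ?_)
  have hfac : ∀ x, (Matrix.gibbsState β H (productOp fun _ : TorusSite d L => F (τ x))).re =
      if x ∈ D then (Matrix.gibbsState β H (productOp fun _ : TorusSite d L => f (σ x))).re
      else 1 := by
    intro x
    simp only [hτ, hF]
    split_ifs
    · rfl
    · rw [Option.elim_none, productOp_one, subsetAux_gibbsState_one L hH, Complex.one_re]
  simp_rw [hfac]
  rw [Finset.prod_ite_mem, Finset.univ_inter]

/-- **`|Re⟨⨂_{x ∈ D} f⟩|^{L^d} ≤ Re⟨⨂_Λ f⟩^{|D|}`** — one real single-site observable `f` on the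
sites of `D`, identity elsewhere (FILS Cor. 4.4 / FL (1.38): the constrained sites each contribute
one factor `⟨P_Λ⟩^{1/|Λ|}`). [cite: FrohlichLieb1978, eqs. (1.38), (1.42)]
[cite: FrohlichIsraelLiebSimon1978, Thm. 4.3] -/
theorem chessboard_estimate_gibbs_subset (hd : 0 < d) (hL : Even L) {β : ℝ}
    {H : Op (TorusSite d L) (n + 1)} (hH : H.IsHermitian)
    (hK : ∀ (j : Fin d) (a : ZMod L), IsRPExponent L j a hL (-(β : ℂ) • H))
    (f : Matrix (Fin (n + 1)) (Fin (n + 1)) ℂ) (hf : f.map (starRingEnd ℂ) = f)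
    (D : Finset (TorusSite d L)) :
    |(Matrix.gibbsState β H (productOp fun x => if x ∈ D then f else 1)).re| ^ (L ^ d) ≤
      (Matrix.gibbsState β H (productOp fun _ : TorusSite d L => f)).re ^ D.card := by
  have h := chessboard_estimate_gibbs_finset L hd hL hH hK (fun _ : Unit => f) (fun _ => hf) D
    (fun _ => ())
  rwa [prod_const] at h

/-- **`Re⟨⨂_{x ∈ D} f⟩ ≤ Re⟨⨂_Λ f⟩^{|D|/L^d}`** (real exponent): Fröhlich–Lieb's form of the
chessboard estimate in the Peierls argument — the probability that all sites of `D` are "bad" is at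
most the `|D|/|Λ|`-th power of the probability that all sites of the torus are bad.
[cite: FrohlichLieb1978, eqs. (1.42), (1.45)] [cite: FrohlichIsraelLiebSimon1978, Thm. 4.3] -/
theorem re_gibbsState_productOp_subset_le_rpow (hd : 0 < d) (hL : Even L) {β : ℝ}
    {H : Op (TorusSite d L) (n + 1)} (hH : H.IsHermitian)
    (hK : ∀ (j : Fin d) (a : ZMod L), IsRPExponent L j a hL (-(β : ℂ) • H))
    (f : Matrix (Fin (n + 1)) (Fin (n + 1)) ℂ) (hf : f.map (starRingEnd ℂ) = f)
    (D : Finset (TorusSite d L)) :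
    (Matrix.gibbsState β H (productOp fun x => if x ∈ D then f else 1)).re ≤
      (Matrix.gibbsState β H (productOp fun _ : TorusSite d L => f)).re ^
        ((D.card : ℝ) / ((L ^ d : ℕ) : ℝ)) := by
  have h := chessboard_estimate_gibbs_subset L hd hL hH hK f hf D
  have ha := re_gibbsState_productOp_universal_nonneg L hd hL hH hK f hf
  have hn : (L ^ d : ℕ) ≠ 0 := pow_ne_zero _ (NeZero.ne L)
  set r := (Matrix.gibbsState β H (productOp fun x => if x ∈ D then f else 1)).re
  set a := (Matrix.gibbsState β H (productOp fun _ : TorusSite d L => f)).re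
  calc r ≤ |r| := le_abs_self r
    _ = (|r| ^ (L ^ d)) ^ (((L ^ d : ℕ) : ℝ))⁻¹ :=
      (Real.pow_rpow_inv_natCast (abs_nonneg r) hn).symm
    _ ≤ (a ^ D.card) ^ (((L ^ d : ℕ) : ℝ))⁻¹ :=
      Real.rpow_le_rpow (pow_nonneg (abs_nonneg r) _) h (inv_nonneg.2 (Nat.cast_nonneg _))
    _ = a ^ ((D.card : ℝ) / ((L ^ d : ℕ) : ℝ)) := by
      rw [← Real.rpow_natCast a D.card, ← Real.rpow_mul ha, div_eq_mul_inv]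

end Sites

/-! ### Cubes of side `b` as basic elements -/

section Blocks

variable {d : ℕ} {N b : ℕ} [NeZero N] [NeZero b] {n : ℕ} {ι : Type*}

omit [NeZero N] [NeZero b] in
/-- The Gibbs state on the block torus is normalised. [folklore] -/
private theorem subsetAux_gibbsState_one_blocks [NeZero (N * b)]
    {H : Op (TorusSite d (N * b)) (n + 1)} (hH : H.IsHermitian) (β : ℝ) :
    Matrix.gibbsState β H 1 = 1 := by
  haveI : Nonempty (TensorIndex (TorusSite d (N * b)) (n + 1)) := ⟨fun _ => 0⟩
  exact Matrix.gibbsState_one β H (Matrix.partitionFn_pos β hH).ne'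

/-- **`0 ≤ Re⟨P_Λ(p)⟩`**: the expectation of the mirror-tiled universal observable of a real block
pattern is nonnegative (the block chessboard estimate of the constant labelling).
[cite: FrohlichLieb1978, eqs. (1.36), (1.42)] -/
theorem re_gibbsState_blockPattern_universal_nonneg [NeZero (N * b)] (hd : 0 < d) (hN : Even N)
    (hN1 : 1 < N) {β : ℝ} {H : Op (TorusSite d (N * b)) (n + 1)} (hH : H.IsHermitian)
    (hK : ∀ (i : Fin d) (k : ZMod N),
      IsRPExponent (N * b) i (blockPlane N b k) (hN.mul_right b) (-(β : ℂ) • H))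
    (p : (Fin d → Fin b) → Matrix (Fin (n + 1)) (Fin (n + 1)) ℂ)
    (hp : ∀ o, (p o).map (starRingEnd ℂ) = p o) :
    0 ≤ (Matrix.gibbsState β H (productOp fun y => p (mirroredOffset hN y))).re := by
  have h := chessboard_estimate_blocks_gibbs_real hd hN hN1 hH hK (fun _ : Unit => p)
    (fun _ o => hp o) (fun _ => ())
  rw [prod_const, card_univ] at h
  have hcard : Fintype.card (BlockIdx d N) = N ^ d := by
    rw [Fintype.card_pi, prod_const, ZMod.card, card_univ, Fintype.card_fin]
  rw [hcard] at h
  -- `|a|^{N^d} ≤ a^{N^d}` forces `0 ≤ a` (`N^d` odd or even: if `a < 0` and `N^d` odd the right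
  -- side is negative; if even, `|a|^{N^d} = a^{N^d}` and nothing is learned — use `N ^ d ≥ 1`
  -- and the sign directly)
  by_contra hneg
  rw [not_le] at hneg
  set a := (Matrix.gibbsState β H (productOp fun y => p (mirroredOffset hN y))).re
  have hNd : N ^ d ≠ 0 := pow_ne_zero _ (NeZero.ne N)
  rcases Nat.even_or_odd (N ^ d) with he | ho
  · -- even exponent: apply the estimate to the labelling with ONE free block instead
    classical
    obtain ⟨c₀⟩ : Nonempty (BlockIdx d N) := ⟨fun _ => 0⟩
    have h1 := chessboard_estimate_blocks_gibbs_real hd hN hN1 hH hK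
      (fun o : Option Unit =>
        o.elim (fun _ => (1 : Matrix (Fin (n + 1)) (Fin (n + 1)) ℂ)) fun _ => p)
      (by rintro (_ | _) o; exacts [Matrix.map_one _ (map_zero _) (map_one _), hp o])
      (fun c => if c = c₀ then none else some ())
    have hfac : ∀ c : BlockIdx d N, (Matrix.gibbsState β H (productOp fun y =>
        ((if c = c₀ then none else some ()) : Option Unit).elim
          (fun _ => (1 : Matrix (Fin (n + 1)) (Fin (n + 1)) ℂ)) (fun _ => p)
          (mirroredOffset hN y))).re = if c = c₀ then 1 else a := by
      intro c
      split_ifs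
      · simp only [Option.elim_none, productOp_one, subsetAux_gibbsState_one_blocks hH,
          Complex.one_re]
      · rfl
    simp_rw [hfac] at h1
    rw [prod_ite, prod_const_one, one_mul, prod_const, filter_ne', card_erase_of_mem (mem_univ _),
      card_univ, hcard] at h1
    have hodd : Odd (N ^ d - 1) := by
      rcases he with ⟨k, hk⟩
      exact ⟨k - 1, by omega⟩
    have hlt : a ^ (N ^ d - 1) < 0 := hodd.pow_neg hneg
    exact absurd (lt_of_le_of_lt h1 hlt) (not_lt.2 (pow_nonneg (abs_nonneg _) _))
  · have hlt : a ^ (N ^ d) < 0 := ho.pow_neg hneg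
    exact absurd (lt_of_le_of_lt h hlt) (not_lt.2 (pow_nonneg (abs_nonneg _) _))

/-- **The block chessboard estimate for a pattern on a subset of the cubes**: real patterns
`p_{τ c}` placed (mirrored by block parity, FL (1.35)) on the cubes `c ∈ D`, identity on the other
cubes: `|Re⟨⨂_{c ∈ D} p_{τ c}⟩|^{N^d} ≤ ∏_{c ∈ D} Re⟨P_Λ(p_{τ c})⟩`.
[cite: FrohlichLieb1978, eqs. (1.36), (1.42)] [cite: FrohlichIsraelLiebSimon1978, Thm. 4.3] -/
theorem chessboard_estimate_blocks_gibbs_finset [NeZero (N * b)] (hd : 0 < d) (hN : Even N)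
    (hN1 : 1 < N) {β : ℝ} {H : Op (TorusSite d (N * b)) (n + 1)} (hH : H.IsHermitian)
    (hK : ∀ (i : Fin d) (k : ZMod N),
      IsRPExponent (N * b) i (blockPlane N b k) (hN.mul_right b) (-(β : ℂ) • H))
    (p : ι → (Fin d → Fin b) → Matrix (Fin (n + 1)) (Fin (n + 1)) ℂ)
    (hp : ∀ lbl o, (p lbl o).map (starRingEnd ℂ) = p lbl o) (D : Finset (BlockIdx d N))
    (τ : BlockIdx d N → ι) :
    |(Matrix.gibbsState β H (productOp fun x =>
        if blockOf N b x ∈ D then p (τ (blockOf N b x)) (mirroredOffset hN x) else 1)).re| ^ (N ^ d)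
      ≤
      ∏ c ∈ D, (Matrix.gibbsState β H (productOp fun y => p (τ c) (mirroredOffset hN y))).re := by
  classical
  set P : Option ι → (Fin d → Fin b) → Matrix (Fin (n + 1)) (Fin (n + 1)) ℂ :=
    fun o => o.elim (fun _ => 1) p with hP
  have hPreal : ∀ o off, (P o off).map (starRingEnd ℂ) = P o off := by
    rintro (_ | lbl) off
    · exact Matrix.map_one _ (map_zero _) (map_one _)
    · exact hp lbl off
  set τ' : BlockIdx d N → Option ι := fun c => if c ∈ D then some (τ c) else none with hτ'
  have hobs : (productOp fun x =>
      if blockOf N b x ∈ D then p (τ (blockOf N b x)) (mirroredOffset hN x) else 1) =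
      productOp fun x => P (τ' (blockOf N b x)) (mirroredOffset hN x) := by
    congr 1
    funext x
    simp only [hτ', hP]
    split_ifs <;> rfl
  have h := chessboard_estimate_blocks_gibbs_real hd hN hN1 hH hK P hPreal τ'
  rw [← hobs] at h
  refine h.trans (le_of_eq ?_)
  have hfac : ∀ c, (Matrix.gibbsState β H (productOp fun y => P (τ' c) (mirroredOffset hN y))).re =
      if c ∈ D then (Matrix.gibbsState β H (productOp fun y => p (τ c) (mirroredOffset hN y))).re
      else 1 := by
    intro c
    simp only [hτ', hP]
    split_ifs
    · rfl
    · simp only [Option.elim_none, productOp_one, subsetAux_gibbsState_one_blocks hH,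
        Complex.one_re]
  simp_rw [hfac]
  rw [Finset.prod_ite_mem, Finset.univ_inter]

/-- **`|Re⟨⨂_{c ∈ D} p⟩|^{N^d} ≤ Re⟨P_Λ(p)⟩^{|D|}`**: one real block pattern `p` on the cubes of `D`
(mirrored by block parity), identity elsewhere; `P_Λ(p)` the mirror-tiled universal projection of FL
(1.36). [cite: FrohlichLieb1978, eqs. (1.36), (1.42)] -/
theorem chessboard_estimate_blocks_gibbs_subset [NeZero (N * b)] (hd : 0 < d) (hN : Even N)
    (hN1 : 1 < N) {β : ℝ} {H : Op (TorusSite d (N * b)) (n + 1)} (hH : H.IsHermitian)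
    (hK : ∀ (i : Fin d) (k : ZMod N),
      IsRPExponent (N * b) i (blockPlane N b k) (hN.mul_right b) (-(β : ℂ) • H))
    (p : (Fin d → Fin b) → Matrix (Fin (n + 1)) (Fin (n + 1)) ℂ)
    (hp : ∀ o, (p o).map (starRingEnd ℂ) = p o) (D : Finset (BlockIdx d N)) :
    |(Matrix.gibbsState β H (productOp fun x =>
        if blockOf N b x ∈ D then p (mirroredOffset hN x) else 1)).re| ^ (N ^ d) ≤
      (Matrix.gibbsState β H (productOp fun y => p (mirroredOffset hN y))).re ^ D.card := by
  have h := chessboard_estimate_blocks_gibbs_finset hd hN hN1 hH hK (fun _ : Unit => p)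
    (fun _ o => hp o) D (fun _ => ())
  rwa [prod_const] at h

/-- **Fröhlich–Lieb (1.42): `Re⟨⨂_{c ∈ D} p⟩ ≤ Re⟨P_Λ(p)⟩^{|D|/N^d}`** — a real block pattern on
`|D|` of the `N^d` cubes is bounded by the `|D|/N^d`-th power of the expectation of its universal
projection ("`P_γ̃ ≤ ⟨P_Λ⟩^{|γ̃|/|Λ|}`", the contour piece `γ̃` occupying `|γ̃|` basic elements).
[cite: FrohlichLieb1978, eqs. (1.42), (1.45)] [cite: FrohlichIsraelLiebSimon1978, Thm. 4.3] -/
theorem re_gibbsState_blockPattern_subset_le_rpow [NeZero (N * b)] (hd : 0 < d) (hN : Even N)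
    (hN1 : 1 < N) {β : ℝ} {H : Op (TorusSite d (N * b)) (n + 1)} (hH : H.IsHermitian)
    (hK : ∀ (i : Fin d) (k : ZMod N),
      IsRPExponent (N * b) i (blockPlane N b k) (hN.mul_right b) (-(β : ℂ) • H))
    (p : (Fin d → Fin b) → Matrix (Fin (n + 1)) (Fin (n + 1)) ℂ)
    (hp : ∀ o, (p o).map (starRingEnd ℂ) = p o) (D : Finset (BlockIdx d N)) :
    (Matrix.gibbsState β H (productOp fun x =>
        if blockOf N b x ∈ D then p (mirroredOffset hN x) else 1)).re ≤
      (Matrix.gibbsState β H (productOp fun y => p (mirroredOffset hN y))).re ^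
        ((D.card : ℝ) / ((N ^ d : ℕ) : ℝ)) := by
  have h := chessboard_estimate_blocks_gibbs_subset hd hN hN1 hH hK p hp D
  have ha := re_gibbsState_blockPattern_universal_nonneg hd hN hN1 hH hK p hp
  have hn : (N ^ d : ℕ) ≠ 0 := pow_ne_zero _ (NeZero.ne N)
  set r := (Matrix.gibbsState β H (productOp fun x =>
    if blockOf N b x ∈ D then p (mirroredOffset hN x) else 1)).re
  set a := (Matrix.gibbsState β H (productOp fun y => p (mirroredOffset hN y))).re
  calc r ≤ |r| := le_abs_self r
    _ = (|r| ^ (N ^ d)) ^ (((N ^ d : ℕ) : ℝ))⁻¹ :=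
      (Real.pow_rpow_inv_natCast (abs_nonneg r) hn).symm
    _ ≤ (a ^ D.card) ^ (((N ^ d : ℕ) : ℝ))⁻¹ :=
      Real.rpow_le_rpow (pow_nonneg (abs_nonneg r) _) h (inv_nonneg.2 (Nat.cast_nonneg _))
    _ = a ^ ((D.card : ℝ) / ((N ^ d : ℕ) : ℝ)) := by
      rw [← Real.rpow_natCast a D.card, ← Real.rpow_mul ha, div_eq_mul_inv]

end Blocks

end Literature.MathematicalPhysics.QuantumLattice

end
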